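import Literature.NumberTheory.EllipticCurves.BSDSelmerSmithSieveDensityProofs
import Literature.NumberTheory.LFunctions.DirichletDensityLemmas
import HarnessLib

/-!
# Null sets of twists from a sieve, II: sets of primes of positive Dirichlet density; finite families

Topic `Literature/NumberTheory/EllipticCurves`, namespace `Literature.NumberTheory.EllipticCurves` (that of
`twistDensity`, file `BSDSelmer`, bsd.S34). Pure-proof file: theorems only, no definition, no named fact.
Sequel of `BSDSelmerSmithSieveDensityProofs` (`twistDensity_zero_forall_prime_not_dvd`: the squarefree `d`
with no prime factor in a set `P` of primes with `∑_{p ∈ P} 1/p = ∞` form a null set).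

* §1 **Dirichlet density feeds the sieve.** In the currency of the tree's
  `Literature.NumberTheory.LFunctions.PrimeSum` (`DirichletDensityLemmas`: `F_X(s) = ∑_{p ∈ X} p^{-s}`, Dirichlet
  density `d` = `F_X(s)/log(1/(s−1)) → d` as `s → 1⁺`; Neukirch VII (13.1), Serre *Cours* VI.4.1): a set
  `X` of primes whose reciprocal series CONVERGES has Dirichlet density `0`
  (`tendsto_primeSum_div_log_zero_of_summable`; `F_X(s) ≤ ∑_{p ∈ X} 1/p` for `s ≥ 1`), hence a set of
  POSITIVE Dirichlet density has `∑_{p ∈ X} 1/p = ∞` (`not_summable_one_div_on_primes_of_dirichletDensity_pos`)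
  and the squarefree `d` with no prime factor in it are null
  (`twistDensity_zero_forall_prime_not_dvd_of_dirichletDensity_pos`; density-one form
  `twistDensity_one_exists_prime_dvd_of_dirichletDensity_pos`). This is the form in which every
  Chebotarev / Frobenius-class density theorem of the tree (abelian: `AbelianFrobeniusDensity`) supplies
  auxiliary prime factors of the twist parameter.
* §2 **Finite families.** Finite intersections of density-one sets have density one
  (`twistDensity_one_forall_mem_finset`); so for any finite family of reduced residue classes
  `(a_i mod k_i)`, `100 %` of the squarefree `d` have, for every `i`, a prime factor `q_i ≡ a_i (mod k_i)`
  (`twistDensity_one_forall_exists_prime_mod_dvd`), and the exceptional `d` form a null set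
  (`twistDensity_zero_exists_forall_prime_mod_not_dvd`).

References: J. Neukirch, *Algebraic Number Theory*, Springer 1999, VII (13.1)–(13.2) (Dirichlet density)
[NeukirchANT1999]; H. L. Montgomery, R. C. Vaughan, *Multiplicative Number Theory I*, CUP 2007, §3.1 Thm. 3.1
and Cor. 4.12 (c)–(d) [MontgomeryVaughan2007]; A. Smith, arXiv:2503.17619, §1 (density convention)
[arXiv250317619].
-/

noncomputable section

open Filter Topology Finset

namespace Literature.NumberTheory.EllipticCurves

/-! ## §1 Sets of primes of positive Dirichlet density -/

section DirichletDensity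

variable {X : Set ℕ} [∀ p : ℕ, Decidable (p.Prime ∧ p ∈ X)]

/-- Termwise comparison: for `s ≥ 1`, the general term `p^{-s}` of `F_X(s)` is at most the term `1/p` of
the reciprocal series of `X`. [folklore] -/
private theorem primeSum_term_le_indicator {s : ℝ} (hs : 1 ≤ s) (p : ℕ) :
    (if p.Prime ∧ p ∈ X then (p : ℝ) ^ (-s) else 0) ≤
      Set.indicator {p : ℕ | p.Prime ∧ p ∈ X} (fun n ↦ (1 : ℝ) / n) p := by
  by_cases h : p.Prime ∧ p ∈ X
  · rw [if_pos h, Set.indicator_of_mem (show p ∈ {p : ℕ | p.Prime ∧ p ∈ X} from h)]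
    have hp1 : (1 : ℝ) ≤ p := by exact_mod_cast h.1.one_lt.le
    calc (p : ℝ) ^ (-s) ≤ (p : ℝ) ^ (-(1 : ℝ)) := Real.rpow_le_rpow_of_exponent_le hp1 (by linarith)
      _ = 1 / p := by rw [Real.rpow_neg_one, one_div]
  · rw [if_neg h, Set.indicator_of_notMem (show p ∉ {p : ℕ | p.Prime ∧ p ∈ X} from h)]

/-- **A set of primes whose reciprocal series converges has Dirichlet density `0`:** if
`∑_{p ∈ X} 1/p < ∞` then `F_X(s) / log(1/(s−1)) → 0` as `s → 1⁺`, since `0 ≤ F_X(s) ≤ ∑_{p ∈ X} 1/p` for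
`s > 1`. [cite: NeukirchANT1999, VII (13.1)–(13.2) (Dirichlet density; finite/convergent sets are negligible)] -/
theorem tendsto_primeSum_div_log_zero_of_summable
    (hX : Summable (Set.indicator {p : ℕ | p.Prime ∧ p ∈ X} fun n ↦ (1 : ℝ) / n)) :
    Tendsto (fun s : ℝ ↦ (∑' p : ℕ, (if p.Prime ∧ p ∈ X then (p : ℝ) ^ (-s) else 0)) /
      Real.log (1 / (s - 1))) (𝓝[>] (1 : ℝ)) (𝓝 0) := by
  have hc : Tendsto (fun s : ℝ ↦ (∑' p : ℕ, Set.indicator {p : ℕ | p.Prime ∧ p ∈ X}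
      (fun n ↦ (1 : ℝ) / n) p) / Real.log (1 / (s - 1))) (𝓝[>] (1 : ℝ)) (𝓝 0) :=
    tendsto_const_nhds.div_atTop LFunctions.PrimeSum.tendsto_log_one_div_sub_one
  refine tendsto_of_tendsto_of_tendsto_of_le_of_le' tendsto_const_nhds hc
    (LFunctions.PrimeSum.eventually_div_log_nonneg X) ?_
  filter_upwards [LFunctions.PrimeSum.eventually_log_pos, LFunctions.PrimeSum.eventually_one_lt]
    with s hlog hs
  exact div_le_div_of_nonneg_right (Summable.tsum_le_tsum (fun p ↦ primeSum_term_le_indicator hs.le p)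
    (LFunctions.PrimeSum.summable X hs) hX) hlog.le

/-- **Positive Dirichlet density ⇒ `∑_{p ∈ X} 1/p = ∞`.** If `F_X(s)/log(1/(s−1)) → d > 0` as `s → 1⁺`
then the reciprocal series of `X` diverges (else the limit would be `0`,
`tendsto_primeSum_div_log_zero_of_summable`). [cite: NeukirchANT1999, VII (13.1)–(13.2)] -/
theorem not_summable_one_div_on_primes_of_dirichletDensity_pos {d : ℝ} (hpos : 0 < d)
    (hd : Tendsto (fun s : ℝ ↦ (∑' p : ℕ, (if p.Prime ∧ p ∈ X then (p : ℝ) ^ (-s) else 0)) /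
      Real.log (1 / (s - 1))) (𝓝[>] (1 : ℝ)) (𝓝 d)) :
    ¬ Summable (Set.indicator {p : ℕ | p.Prime ∧ p ∈ X} fun n ↦ (1 : ℝ) / n) :=
  fun hX ↦ hpos.ne' (tendsto_nhds_unique hd (tendsto_primeSum_div_log_zero_of_summable hX))

/-- **Twists with no prime factor in a set of primes of positive Dirichlet density are null.** If `X` has
Dirichlet density `d > 0` then the squarefree `n` divisible by no prime of `X` have natural density `0`
(`twistDensity_zero_forall_prime_not_dvd` fed by `not_summable_one_div_on_primes_of_dirichletDensity_pos`).
[cite: MontgomeryVaughan2007, §3.1 Thm. 3.1] [cite: NeukirchANT1999, VII (13.1)–(13.2)] -/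
theorem twistDensity_zero_forall_prime_not_dvd_of_dirichletDensity_pos {d : ℝ} (hpos : 0 < d)
    (hd : Tendsto (fun s : ℝ ↦ (∑' p : ℕ, (if p.Prime ∧ p ∈ X then (p : ℝ) ^ (-s) else 0)) /
      Real.log (1 / (s - 1))) (𝓝[>] (1 : ℝ)) (𝓝 d)) :
    twistDensity (fun n : ℤ ↦ ∀ p : ℕ, p.Prime → p ∈ X → ¬ (p : ℤ) ∣ n) 0 :=
  twistDensity_zero_forall_prime_not_dvd (P := fun p ↦ p ∈ X)
    (not_summable_one_div_on_primes_of_dirichletDensity_pos hpos hd)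

/-- **`100 %` of the squarefree `n` have a prime factor in `X`** when `X` has positive Dirichlet density.
[cite: MontgomeryVaughan2007, §3.1 Thm. 3.1] [cite: NeukirchANT1999, VII (13.1)–(13.2)] -/
theorem twistDensity_one_exists_prime_dvd_of_dirichletDensity_pos {d : ℝ} (hpos : 0 < d)
    (hd : Tendsto (fun s : ℝ ↦ (∑' p : ℕ, (if p.Prime ∧ p ∈ X then (p : ℝ) ^ (-s) else 0)) /
      Real.log (1 / (s - 1))) (𝓝[>] (1 : ℝ)) (𝓝 d)) :
    twistDensity (fun n : ℤ ↦ ∃ p : ℕ, p.Prime ∧ p ∈ X ∧ (p : ℤ) ∣ n) 1 :=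
  twistDensity_one_exists_prime_dvd (P := fun p ↦ p ∈ X)
    (not_summable_one_div_on_primes_of_dirichletDensity_pos hpos hd)

end DirichletDensity

/-! ## §2 Finite families of conditions -/

section Families

open scoped Classical

/-- **Finite intersections of density-one sets of twists have density one** (induction on
`twistDensity.and_one`; the bookkeeping by which "`100 %` of the twists" statements are combined in
Smith, arXiv:2503.17619, §1, proofs of Cor. 1.2–1.3). [cite: arXiv250317619, §1 (Cor. 1.2–1.3, density-one bookkeeping)] -/
theorem twistDensity_one_forall_mem_finset {ι : Type*} (s : Finset ι) {R : ι → ℤ → Prop}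
    (h : ∀ i ∈ s, twistDensity (R i) 1) : twistDensity (fun d ↦ ∀ i ∈ s, R i d) 1 := by
  induction s using Finset.cons_induction with
  | empty => exact twistDensity_one_of_forall fun d _ i hi ↦ by simp at hi
  | cons a s ha ih =>
    have h1 : twistDensity (R a) 1 := h a (Finset.mem_cons_self a s)
    have h2 : twistDensity (fun d ↦ ∀ i ∈ s, R i d) 1 := ih fun i hi ↦ h i (Finset.mem_cons_of_mem hi)
    refine (twistDensity_congr (fun d _ ↦ ?_) 1).1 (h1.and_one h2)
    rw [Finset.forall_mem_cons]

/-- **For any finite family of reduced residue classes `(a_i mod k_i)`, `100 %` of the squarefree `d`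
have, for every `i`, a prime factor `q_i ≡ a_i (mod k_i)`** (Dirichlet in reciprocal form, the sieve, and
finite intersection). [cite: MontgomeryVaughan2007, Cor. 4.12 (c) (p. 90) and §3.1 Thm. 3.1] -/
theorem twistDensity_one_forall_exists_prime_mod_dvd {ι : Type*} (s : Finset ι) (k a : ι → ℕ)
    (hk : ∀ i ∈ s, 0 < k i) (hak : ∀ i ∈ s, Nat.Coprime (a i) (k i)) :
    twistDensity (fun d : ℤ ↦ ∀ i ∈ s, ∃ q : ℕ, q.Prime ∧ q % k i = a i % k i ∧ (q : ℤ) ∣ d) 1 :=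
  twistDensity_one_forall_mem_finset s fun i hi ↦
    twistDensity_one_exists_prime_mod_dvd (k i) (a i) (hk i hi) (hak i hi)

/-- **The exceptional twists of a finite family of residue classes are null**: the squarefree `d` lacking,
for SOME `i`, any prime factor `q ≡ a_i (mod k_i)` have density `0` (complement of
`twistDensity_one_forall_exists_prime_mod_dvd`). [cite: MontgomeryVaughan2007, Cor. 4.12 (c) (p. 90) and §3.1 Thm. 3.1] -/
theorem twistDensity_zero_exists_forall_prime_mod_not_dvd {ι : Type*} (s : Finset ι) (k a : ι → ℕ)
    (hk : ∀ i ∈ s, 0 < k i) (hak : ∀ i ∈ s, Nat.Coprime (a i) (k i)) :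
    twistDensity
      (fun d : ℤ ↦ ∃ i ∈ s, ∀ q : ℕ, q.Prime → q % k i = a i % k i → ¬ (q : ℤ) ∣ d) 0 := by
  have h := (twistDensity_one_forall_exists_prime_mod_dvd s k a hk hak).compl
  rw [sub_self] at h
  refine (twistDensity_congr (fun d _ ↦ ?_) 0).1 h
  simp only [not_forall, not_exists, not_and, exists_prop]

end Families

/-! ## §3 Large auxiliary primes: removing finitely many primes keeps divergence -/

section Large

open scoped Classical

variable {P : ℕ → Prop}

/-- **Removing the primes `≤ B` from a divergent set keeps it divergent**: if `∑_{p prime, P p} 1/p = ∞`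
then `∑_{p prime, P p, p > B} 1/p = ∞` (the removed part is a finite sum).
[cite: MontgomeryVaughan2007, Cor. 4.12 (c) (p. 90) (tails of a divergent series)] -/
theorem not_summable_indicator_primes_gt (B : ℕ)
    (hP : ¬ Summable (Set.indicator {p : ℕ | p.Prime ∧ P p} fun n ↦ (1 : ℝ) / n)) :
    ¬ Summable (Set.indicator {p : ℕ | p.Prime ∧ (P p ∧ B < p)} fun n ↦ (1 : ℝ) / n) := by
  intro h
  have hfin : Summable (Set.indicator {p : ℕ | p.Prime ∧ (P p ∧ p ≤ B)} fun n ↦ (1 : ℝ) / n) := by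
    refine summable_of_ne_finset_zero (s := Finset.range (B + 1)) fun n hn ↦ ?_
    rw [Finset.mem_range, Nat.lt_succ_iff] at hn
    exact Set.indicator_of_notMem (fun hm ↦ hn hm.2.2) _
  refine hP ((h.add hfin).of_nonneg_of_le
    (fun n ↦ Set.indicator_nonneg (fun m _ ↦ by positivity) n) fun n ↦ ?_)
  by_cases hn : n ∈ {p : ℕ | p.Prime ∧ P p}
  · rcases lt_or_ge B n with hB | hB
    · rw [Set.indicator_of_mem hn, Set.indicator_of_mem (show n ∈ {p : ℕ | p.Prime ∧ (P p ∧ B < p)}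
        from ⟨hn.1, hn.2, hB⟩)]
      exact le_add_of_nonneg_right (Set.indicator_nonneg (fun m _ ↦ by positivity) n)
    · rw [Set.indicator_of_mem hn, Set.indicator_of_mem (show n ∈ {p : ℕ | p.Prime ∧ (P p ∧ p ≤ B)}
        from ⟨hn.1, hn.2, hB⟩)]
      exact le_add_of_nonneg_left (Set.indicator_nonneg (fun m _ ↦ by positivity) n)
  · rw [Set.indicator_of_notMem hn]
    exact add_nonneg (Set.indicator_nonneg (fun m _ ↦ by positivity) n)
      (Set.indicator_nonneg (fun m _ ↦ by positivity) n)

/-- **`100 %` of the squarefree `d` have a prime factor `p ∈ P` with `p > B`**, for every bound `B`, when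
`∑_{p ∈ P} 1/p = ∞`. [cite: MontgomeryVaughan2007, §3.1 Thm. 3.1 and Cor. 4.12 (c)–(d)] -/
theorem twistDensity_one_exists_prime_gt_dvd (B : ℕ)
    (hP : ¬ Summable (Set.indicator {p : ℕ | p.Prime ∧ P p} fun n ↦ (1 : ℝ) / n)) :
    twistDensity (fun d : ℤ ↦ ∃ p : ℕ, p.Prime ∧ (P p ∧ B < p) ∧ (p : ℤ) ∣ d) 1 :=
  twistDensity_one_exists_prime_dvd (not_summable_indicator_primes_gt B hP)

/-- The null-set form: the squarefree `d` with no prime factor `p ∈ P`, `p > B`, have density `0`.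
[cite: MontgomeryVaughan2007, §3.1 Thm. 3.1 and Cor. 4.12 (c)–(d)] -/
theorem twistDensity_zero_forall_prime_gt_not_dvd (B : ℕ)
    (hP : ¬ Summable (Set.indicator {p : ℕ | p.Prime ∧ P p} fun n ↦ (1 : ℝ) / n)) :
    twistDensity (fun d : ℤ ↦ ∀ p : ℕ, p.Prime → (P p ∧ B < p) → ¬ (p : ℤ) ∣ d) 0 :=
  twistDensity_zero_forall_prime_not_dvd (not_summable_indicator_primes_gt B hP)

/-- **Dirichlet, large-prime form**: for `k ≥ 1`, `(a, k) = 1` and any `B`, `100 %` of the squarefree `d`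
have a prime factor `q ≡ a (mod k)` with `q > B`. [cite: MontgomeryVaughan2007, Cor. 4.12 (c) (p. 90) and §3.1 Thm. 3.1] -/
theorem twistDensity_one_exists_prime_mod_gt_dvd (k a : ℕ) (hk : 0 < k) (hak : Nat.Coprime a k) (B : ℕ) :
    twistDensity (fun d : ℤ ↦ ∃ q : ℕ, q.Prime ∧ (q % k = a % k ∧ B < q) ∧ (q : ℤ) ∣ d) 1 :=
  twistDensity_one_exists_prime_gt_dvd B
    (LFunctions.not_summable_one_div_on_primes_in_residueClass k a hk hak)

/-- Null-set form of `twistDensity_one_exists_prime_mod_gt_dvd`. [cite: MontgomeryVaughan2007, Cor. 4.12 (c) (p. 90) and §3.1 Thm. 3.1] -/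
theorem twistDensity_zero_forall_prime_mod_gt_not_dvd (k a : ℕ) (hk : 0 < k) (hak : Nat.Coprime a k)
    (B : ℕ) :
    twistDensity (fun d : ℤ ↦ ∀ q : ℕ, q.Prime → (q % k = a % k ∧ B < q) → ¬ (q : ℤ) ∣ d) 0 :=
  twistDensity_zero_forall_prime_gt_not_dvd B
    (LFunctions.not_summable_one_div_on_primes_in_residueClass k a hk hak)

end Large

end Literature.NumberTheory.EllipticCurves

end
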